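import Literature.AlgebraicGeometry.HodgeTheory.HyperplaneSectionMonodromyProofs   -- ★ `IsHomotopicallyLocallyTrivialOn`, `IsCohomologicallyLocallyTrivialOn.mono`
import Mathlib.Analysis.Convex.Contractible
import Mathlib.AlgebraicTopology.FundamentalGroupoid.SimplyConnected
import HarnessLib

/-!
# Small simply connected chart balls over which a family stays (co)homologically locally trivial (U-e P4b leaf (B1a-W))

Topic `AlgebraicGeometry/HodgeTheory`; namespace `Literature.AlgebraicGeometry.HodgeTheory`.  THEOREMS ONLY (no definition, no
named fact, no instance, no `sorry`).  Cell hodgecm-mathlib (D-0151), (U)-HEAD node U-e, socket P4, step (B1a) of B-p05 (g13)'s plan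
of record (`B-provers/HANDOFF.md` § B-p05 (g13) SEAT CLOSE: «`W` := chart ball in a smooth piece … path-connected, simply connected;
`hU` … + the HOMOTOPICAL variant p726248 needs»); hand B-p03 (g13).  HC_CM is proved only modulo the 7 printed citations until rung 0
closes; books 0.

[VoisinHodgeI2002] Thm. 9.3 / §9.2.1: Ehresmann's trivialisations hold over contractible opens `B ∋ 0`, and local systems are
trivial over simply connected opens.  The P4 road works over ONE such open `W ∋ x₀` inside one coordinate chart: the preimage of a
small ball.  This file packages its topology and the restriction of the tree's local-triviality structures to it:

* `IsHomotopicallyLocallyTrivialOn.mono` — restriction to an open subset (the twin of ★ `IsCohomologicallyLocallyTrivialOn.mono`);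
* `exists_chartBall_nhds` — for a chart `e` at `x` and any neighbourhood `N` of `x`: a radius `ε > 0` with
  `W := e.source ∩ e ⁻¹' ball (e x) ε ⊆ N`, `W` open, `x ∈ W`, `e '' W = ball (e x) ε ⊆ e.target`, and `W` CONTRACTIBLE (homeomorphic
  to the convex ball), hence simply connected and path connected;
* `exists_chartBall_locallyTrivialOn` — for a family `f : 𝒳 → S` homotopically locally trivial over an OPEN `U ∋ x` and a chart `e` of
  `S(ℂ)` at `x`: such a `W ⊆ U` with `IsHomotopicallyLocallyTrivialOn f W` and `IsCohomologicallyLocallyTrivialOn f W` — the base of the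
  flat integral frame of ★ `exists_flatIntegralFrame_eq_of_simplyConnectedSpace` (p726248).

## References
* [VoisinHodgeI2002] C. Voisin, *Hodge Theory and Complex Algebraic Geometry I*, CUP 2002, Thm. 9.3 (with Rem. 9.4) and §9.2.1.
* [HatcherAT2002] A. Hatcher, *Algebraic Topology*, CUP 2002, §1.3 Prop. 1.30 and Ex. 0.11 (convex sets are contractible).
-/

set_option autoImplicit false

noncomputable section

open CategoryTheory AlgebraicGeometry
open _root_.Topology _root_.Filter

namespace Literature.AlgebraicGeometry.HodgeTheory

/-! ### §1 Restriction of homotopical local triviality to open subsets -/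

section Mono

variable {𝒳 S : Motives.SchemeOver ℂ} (π : 𝒳 ⟶ S)

/-- **Homotopical local triviality restricts to open subsets** (the tubes are arbitrarily small, so they can be taken inside any
open `V ⊆ U` around each of its points; twin of ★ `IsCohomologicallyLocallyTrivialOn.mono`). [cite: VoisinHodgeI2002, Thm. 9.3 (with Rem. 9.4)] -/
theorem IsHomotopicallyLocallyTrivialOn.mono {U V : Set (Motives.ComplexPoints S)}
    (hU : IsHomotopicallyLocallyTrivialOn π U) (hVU : V ⊆ U) (hV : IsOpen V) :
    IsHomotopicallyLocallyTrivialOn π V := by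
  refine ⟨fun t ht W hW ↦ ?_⟩
  obtain ⟨B, hBo, htB, hBW, -, he⟩ :=
    hU.exists_nhds_homotopyEquiv (hVU ht) (W ∩ V) (Filter.inter_mem hW (hV.mem_nhds ht))
  exact ⟨B, hBo, htB, fun x hx ↦ (hBW hx).1, fun x hx ↦ (hBW hx).2, he⟩

end Mono

/-! ### §2 Small chart balls: open, contractible (simply connected, path connected), inside any neighbourhood -/

section ChartBall

variable {M : Type*} [TopologicalSpace M] {F : Type*} [NormedAddCommGroup F] [NormedSpace ℝ F]

/-- **Small chart balls.**  For an open partial homeomorphism `e : M → F` into a real normed space (a chart), a point `x ∈ e.source` and a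
neighbourhood `N` of `x`, there is `ε > 0` such that the chart ball `W := e.source ∩ e ⁻¹' ball (e x) ε` is an open neighbourhood of `x`
inside `N`, mapped by `e` ONTO the ball `ball (e x) ε ⊆ e.target`, and CONTRACTIBLE (it is homeomorphic to the convex ball).
[cite: HatcherAT2002, §1.3 Prop. 1.30 and Ex. 0.11] -/
theorem exists_chartBall_nhds (e : OpenPartialHomeomorph M F) {x : M} (hx : x ∈ e.source)
    {N : Set M} (hN : N ∈ 𝓝 x) :
    ∃ ε : ℝ, 0 < ε ∧ Metric.ball (e x) ε ⊆ e.target ∧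
      IsOpen (e.source ∩ e ⁻¹' Metric.ball (e x) ε) ∧ x ∈ e.source ∩ e ⁻¹' Metric.ball (e x) ε ∧
      e.source ∩ e ⁻¹' Metric.ball (e x) ε ⊆ N ∧
      e '' (e.source ∩ e ⁻¹' Metric.ball (e x) ε) = Metric.ball (e x) ε ∧
      ContractibleSpace ↥(e.source ∩ e ⁻¹' Metric.ball (e x) ε) := by
  have himg : e '' (N ∩ e.source) ∈ 𝓝 (e x) :=
    e.image_mem_nhds hx (inter_mem hN (e.open_source.mem_nhds hx))
  obtain ⟨ε, hε, hball⟩ := Metric.mem_nhds_iff.1 himg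
  have htarget : Metric.ball (e x) ε ⊆ e.target := fun y hy ↦ by
    obtain ⟨w', ⟨-, hw's⟩, rfl⟩ := hball hy
    exact e.map_source hw's
  have himage : e '' (e.source ∩ e ⁻¹' Metric.ball (e x) ε) = Metric.ball (e x) ε := by
    rw [e.image_source_inter_eq']
    ext y
    constructor
    · rintro ⟨hyt, hy⟩
      simpa [e.right_inv hyt] using hy
    · intro hy
      exact ⟨htarget hy, by simpa [Set.mem_preimage, e.right_inv (htarget hy)] using hy⟩
  refine ⟨ε, hε, htarget, e.isOpen_inter_preimage Metric.isOpen_ball, ⟨hx, Metric.mem_ball_self hε⟩, ?_, himage, ?_⟩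
  · rintro w ⟨hws, hwb⟩
    obtain ⟨w', ⟨hw'N, hw's⟩, hww'⟩ := hball hwb
    rwa [← e.injOn hw's hws hww']
  · haveI : ContractibleSpace (Metric.ball (e x) ε) :=
      (convex_ball (e x) ε).contractibleSpace ⟨e x, Metric.mem_ball_self hε⟩
    exact (e.homeomorphOfImageSubsetSource Set.inter_subset_left himage).contractibleSpace

/-- A contractible subspace is simply connected (Mathlib) and path connected: recorded for chart balls in the `IsPathConnected` /
`SimplyConnectedSpace` currencies of ★ `exists_flatIntegralFrame_eq(_of_simplyConnectedSpace)`. [cite: HatcherAT2002, §1.3 Prop. 1.30 and Ex. 0.11] -/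
theorem isPathConnected_of_contractibleSpace {W : Set M} [ContractibleSpace W] : IsPathConnected W :=
  isPathConnected_iff_pathConnectedSpace.2 inferInstance

end ChartBall

/-! ### §3 A chart ball over which the family is homotopically and cohomologically locally trivial -/

section Family

variable {𝒳 S : Motives.SchemeOver ℂ} (f : 𝒳 ⟶ S) {F : Type*} [NormedAddCommGroup F] [NormedSpace ℝ F]

/-- **(B1a-W) THE BASE OF THE FLAT FRAME.**  Let `f : 𝒳 → S` be homotopically locally trivial over an OPEN `U ⊆ S(ℂ)` (Ehresmann; for
a smooth proper family over a smooth base ★ `isHomotopicallyLocallyTrivialOn_univ` with `U = univ`), `x ∈ U`, `e` a chart of `S(ℂ)` at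
`x` (e.g. ★ `ComplexPoints.algebraicChart`) and `N` any neighbourhood of `x`.  Then some chart ball `W = e.source ∩ e ⁻¹' ball (e x) ε`
is an open neighbourhood of `x` inside `N ∩ U`, mapped by `e` onto the ball, CONTRACTIBLE — hence simply connected and path connected:
trivial monodromy — and `f` is homotopically AND cohomologically locally trivial over `W` (restriction, §1).  Over such a `W` every
integral basis of `Hᵏ(X_x; ℚ)` extends to a flat integral frame (★ `exists_flatIntegralFrame_eq_of_simplyConnectedSpace`).
[cite: VoisinHodgeI2002, Thm. 9.3 (with Rem. 9.4) and §9.2.1] -/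
theorem exists_chartBall_locallyTrivialOn {U : Set (Motives.ComplexPoints S)} (hU : IsHomotopicallyLocallyTrivialOn f U)
    (hUo : IsOpen U) {x : Motives.ComplexPoints S} (hx : x ∈ U) (e : OpenPartialHomeomorph (Motives.ComplexPoints S) F)
    (hxe : x ∈ e.source) {N : Set (Motives.ComplexPoints S)} (hN : N ∈ 𝓝 x) :
    ∃ ε : ℝ, 0 < ε ∧ Metric.ball (e x) ε ⊆ e.target ∧
      IsOpen (e.source ∩ e ⁻¹' Metric.ball (e x) ε) ∧ x ∈ e.source ∩ e ⁻¹' Metric.ball (e x) ε ∧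
      e.source ∩ e ⁻¹' Metric.ball (e x) ε ⊆ N ∧ e.source ∩ e ⁻¹' Metric.ball (e x) ε ⊆ U ∧
      e '' (e.source ∩ e ⁻¹' Metric.ball (e x) ε) = Metric.ball (e x) ε ∧
      ContractibleSpace ↥(e.source ∩ e ⁻¹' Metric.ball (e x) ε) ∧
      SimplyConnectedSpace ↥(e.source ∩ e ⁻¹' Metric.ball (e x) ε) ∧
      IsPathConnected (e.source ∩ e ⁻¹' Metric.ball (e x) ε) ∧
      IsHomotopicallyLocallyTrivialOn f (e.source ∩ e ⁻¹' Metric.ball (e x) ε) ∧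
      IsCohomologicallyLocallyTrivialOn f (e.source ∩ e ⁻¹' Metric.ball (e x) ε) := by
  obtain ⟨ε, hε, htarget, hWo, hxW, hWN, himage, hcontr⟩ :=
    exists_chartBall_nhds e hxe (Filter.inter_mem hN (hUo.mem_nhds hx))
  have hWU : e.source ∩ e ⁻¹' Metric.ball (e x) ε ⊆ U := fun w hw ↦ (hWN hw).2
  have hh : IsHomotopicallyLocallyTrivialOn f (e.source ∩ e ⁻¹' Metric.ball (e x) ε) := hU.mono f hWU hWo
  haveI := hcontr
  exact ⟨ε, hε, htarget, hWo, hxW, fun w hw ↦ (hWN hw).1, hWU, himage, hcontr, inferInstance,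
    isPathConnected_of_contractibleSpace, hh, hh.isCohomologicallyLocallyTrivialOn⟩

end Family

end Literature.AlgebraicGeometry.HodgeTheory

end
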